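import Literature.MathematicalPhysics.QuantumFieldTheory.Balaban1983to89.B9Eq379QLipschitzGeneral
import Literature.MathematicalPhysics.QuantumFieldTheory.Balaban1983to89.B9Eq315QTower

/-!
# `Balaban1983to89.B7Eq65AverageLipschitz` — T. Bałaban, *Averaging operations for lattice gauge theories*, Commun. Math. Phys. **98** (1985)
# 17–51 [Balaban1985Averaging] (42)–(43) pp. 23–24 with (65) p. 29, (89)/(92) p. 31 and Proposition 7 p. 43: THE BLOCK AVERAGE `U ↦ Ū` IS
# LIPSCHITZ IN THE CONFIGURATION — the relative average `Ũ′ = \overline{U′U₀}·Ū₀⁻¹` of (65) is within `O(1)·sup|log U′|` of `1` at a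
# regular unit-bounded base `U₀`, hence `‖V̄(c) − V̄′(c)‖ ≤ 26384(d+1)L·δ` for `‖V(b)V′(b)⁻¹ − 1‖ ≤ δ`, and along the tower (43)
# `‖Ū^j(b) − Ū′^j(b)‖ ≤ (26384(d+1)L)^j·δ` — the MUTUAL CLOSENESS `δ̄` of two families of averaged backgrounds that the NE9 chain's k-level
# two-background averaging letters (`B9Eq315QTowerLipschitzTwoBackgrounds`, this lineage) display, PRODUCED from the bondwise distance

statement-level skeleton of published theorems with citation tags; proofs where landed; nothing here is a claim about the Yang–Mills mass gap

CITATION HEADER (lean-in-tree rule).  Audit cell `pub-balaban`, sub-cell `t4`, BINDER row NE9; filed by the NE9 crux-team leaf lineage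
`b2b-balaban-t4-ne9-formalise-leaf-04` (gen 74).  Source READ in the held text: [Balaban1985Averaging] pp. 23–24, 29, 31, 43
(`paper:balaban1985-cmp98-averaging`, journal page = PDF page + 16), through the verbatim transcriptions `B7Prop1Explicit` ((42) `bavg`),
`B7Prop2Explicit` ((43) `avgIter`), `B7Eq92Concrete` ((65) `tild`, (89) `dbavgCov`, block frames `wframe`), `B7Prop3GeneralLinear` ((121) `Qcov`).

THE PRINT (verbatim).  (42) p. 23: the one-step average `Ū(c) = exp[Σ_{x∈B(c₋)} L^{−d} log(U(Γ_{c,x})U(c)⁻¹)]·U(c)` (cell reading of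
`B7Prop1Explicit.bavg`); (43) p. 24: *«Ū^{k+1} = \overline{(Ū^k)}»*; (65) p. 29: *«(Ũ′)_c = (\overline{U′U₀})_c(Ū₀)_c⁻¹»*; (92) p. 31 at `k = 1`:
`Ũ₁(c) = w(c₋)·U̿₁(c)·R̄_{0,c}w(c₊)⁻¹` (*«For k = 1 the equality holds by the definitions (89), (90), and the Eq. (63)»*); Proposition 7 p. 43:
`Q(V₀, A, c) = (1∕i) log V̿₁(c)` is analytic and `O(|A|)` at a regular background.  Print states no Lipschitz estimate of `U ↦ Ū`; this file is
the [folklore] reading of (92) through the tree's Prop. 7 bound (`B7Prop7OneStep.norm_Qcov_cplx_le_crude_explicit`, the Cauchy route).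

WHY THIS FILE (cell context).  The NE9 owner's `TOWER-SPECIES-PLAN.md` §2 (e) (two backgrounds at `k` levels): this lineage's
`B9Eq315QTowerLipschitzTwoBackgrounds` produces the `k`-level averaging letters `ρ′_k(U,U′)`, `δ_{Q,k}(U,U′)` modulo the DISPLAYED closeness
`‖Ū^j(b) − Ū′^j(b)‖ ≤ δ̄` of the two families of level averages; the one-background twin (`‖Ū^j(b) − 1‖ ≤ (8(d+1)L)^jε`) is the owner's
`B7Eq43AveragedSmallness`.  This file PRODUCES `δ̄ := (26384(d+1)L)^k·δ` from `‖U(b) − U′(b)‖ ≤ δ`.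

WHAT IS PROVED (sorry-free; proof lane — no `def`, no `Prop` placeholder, no inequality of the paper asserted hypothesis-free).
* §1 `norm_val_bavg_le`, `norm_val_bavg_inv_le` (`‖V̄₀(c)‖, ‖V̄₀(c)⁻¹‖ ≤ 17∕16` for a unit-bounded base with `α`-regular block loops, `α ≤ 1∕64`);
  **`norm_tild_expCfg_sub_one_le`** — THE RELATIVE AVERAGE (65) OF A SMALL FIELD IS NEAR `1`: for `V₀` unit-bounded with `α`-regular block
  loops at `c` (`α ≤ 1∕128`) and `V₁ = e^{A}`, `sup|A_b| ≤ a ≤ c₃(d,L)∕48`: `‖Ṽ₁(c) − 1‖ ≤ 12416(d+1)L·a` — (92) at `k = 1`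
  (`B7Eq92Concrete.tild_eq_frame_dbavgCov`): the frames `w = e^{F}` with `|F| ≤ 4Na` (`norm_Fcov_le_of_tHol` on `norm_tHol_expCfg_sub_one_le_of_length`,
  `N = (2d+2)L`), the double-bar average `V̿₁(c) = e^{Q(V₀,A,c)}` with `|Q| ≤ 6144(d+1)L·a` (Prop. 7, crude explicit), the rotation by `V̄₀(c)`;
  **`norm_bavg_expCfg_mul_sub_bavg_le`** (`‖\overline{e^{A}V₀}(c) − V̄₀(c)‖ ≤ 13192(d+1)L·a`).
* §2 **`norm_bavg_sub_bavg_le`** — TWO BACKGROUNDS: `V′` as `V₀` above, `‖V(b)V′(b)⁻¹ − 1‖ ≤ δ ≤ 1∕(12288(d+1)L)` ⇒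
  `‖V̄(c) − V̄′(c)‖ ≤ 26384(d+1)L·δ` (`V = e^{log(VV′⁻¹)}V′`, `|log(VV′⁻¹)| ≤ 2δ`); **`norm_bavg_sub_bavg_le_of_bonds`** — the same in the NE9
  chain's SMALL-BOND currency: `V′(b) ∈ U1`, `‖V′(b) − 1‖ ≤ ε′` with `2(d+1)L·ε′ ≤ 1∕128` (regularity read off the bonds,
  `B9Eq315QLipschitz.norm_Wcx_sub_one_le`) and ADDITIVE closeness `‖V(b) − V′(b)‖ ≤ δ`, at EVERY `L`-bond `c`.
* §3 **`norm_avgIter_sub_avgIter_le`** — ALONG (43): if the base's level averages `V̄′^j` (`j < J`) are `U1`-valued with `ε′`-small bonds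
  (`2(d+1)Lε′ ≤ 1∕128`) and `(26384(d+1)L)^J·δ ≤ 1∕(12288(d+1)L)`, then `‖V̄^J(b) − V̄′^J(b)‖ ≤ (26384(d+1)L)^J·δ` (induction; the rescaling
  `B7Prop2Explicit.rescale` only relabels bonds).
* §4 **`norm_UlevOf_sub_UlevOf_le`** — THE TOWER READING for two backgrounds `U`, `U′` of the finest torus `T_{L^k m}`: under the DISPLAYED
  letters of `B9Eq315QTowerLipschitzTwoBackgrounds` §3 for `U′` (`Ū′^j(b) ∈ U1`, `‖Ū′^j(b) − 1‖ ≤ ε̄′`, `2(d+1)Lε̄′ ≤ 1∕128`) and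
  `‖U(b) − U′(b)‖ ≤ δ` with `(26384(d+1)L)^k·δ ≤ 1∕(12288(d+1)L)`: `‖UlevOf L m k U j b − UlevOf L m k U′ j b‖ ≤ (26384(d+1)L)^k·δ` for every
  level `j` and bond `b` — the `hUU'` display of `B9Eq315QTowerLipschitzTwoBackgrounds.norm_QprimeTowerW_sub_QprimeTowerW_le` ∕
  `norm_QkW_sub_QkW_le` with `δ̄ := (26384(d+1)L)^k·δ`.
MODEL / DECLARED READINGS.  (M1) `ℤ^d` configurations of units of a complete normed `ℂ`-algebra `𝔸` with `‖1‖ = 1`; the average (42) in the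
cell's `exp ∘ log` reading (`B7Prop1Explicit.bavg`, series logarithm (21)).  (M2) the base must be unit-bounded with regular block loops
(resp. small bonds); the second configuration only CLOSE to it; the unit-boundedness of the base's level averages is DISPLAYED (it needs an
averaging-closed subgroup, `B7Prop2Explicit.AvgClosed` — not here), their smallness is the owner's `B7Eq43AveragedSmallness` (not re-derived).
(M3) constants: `12416∕13192∕26384·(d+1)L` per step, `(26384(d+1)L)^j` along the tower — admissible finite-lattice witnesses by the Cauchy route
(crude; print's Prop. 2 (52)–(54) keeps `α₀L^{−2}`-scaled regularity level by level, a sharper and different statement, NOT this); the windows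
`a ≤ c₃∕48`, `δ ≤ 1∕(12288(d+1)L)` are the analyticity radius', not print's.
HONEST SCOPE.  [folklore] bookkeeping on landed kernel theorems ([B7] Prop. 7 is used through `B7Prop7OneStep`, no inequality of the paper
asserted); one displayed letter of the NE9 chain's `k`-level two-background averaging letters PRODUCED, NOT those letters' consumers, NOT [B9]
Thm 3.11, NOT NE9; NOT summit progress (cell pub-balaban: NE9 NOT PRINTED ∕ NOT PROVED; «NE9 ⇐ the named binders»; spine PROVED 0∕9; rung
(B)+1 on a finite T⁴ — NOT infinite volume, NOT mass gap, NOT Clay).  NEW file importing `B9Eq379QLipschitzGeneral`, `B9Eq315QTower`; nothing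
of the lit-balaban ∕ NE7c ∕ NE9-owner lineages' files is modified.  Net new unproved facts: 0.
-/

noncomputable section

open scoped BigOperators
open NormedSpace

namespace Literature.MathematicalPhysics.QuantumFieldTheory.Balaban1983to89.B7Eq65AverageLipschitz

open B7Prop1Explicit B7Prop3Flat B7Eq92Concrete MatrixLog
open B7Prop3GeneralLinear (Qcov)
open B7Prop3GeneralAnalytic (logDomainCov norm_tHol_expCfg_sub_one_le_of_length norm_Fcov_le_of_tHol norm_Xavg_le_of_Wcx)
open B7Prop7OneStep (norm_Qcov_cplx_le_crude_explicit)
open B7Prop2Explicit (avgIter avgIter_zero avgIter_succ rescale rescale_apply)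
open B9Eq379QLipschitzGeneral (expCfg_mlog_mul)
open B9Eq315QLipschitz (norm_Wcx_sub_one_le)
open B9SectCLatticeCarrier (Bond)
open B9Eq315QTorus (perSite perCfg perCfg_apply)
open B9Eq315QTower (towerP UlevOf perCfg_UlevOf)
open B9Eq315QTorusOnto (liftSite)

-- `Site` alone would resolve to the torus sites of `Setup.lean`; re-export the `ℤ^d` sites of `B7Prop1Explicit`.
export B7Prop1Explicit (Site)

variable {d : ℕ} {𝔸 : Type*} [NormedRing 𝔸] [NormedAlgebra ℂ 𝔸] [CompleteSpace 𝔸] [NormOneClass 𝔸]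

/-! ## §0 [folklore] elementary norm bookkeeping -/

omit [NormOneClass 𝔸] in
/-- `|e^{Y} − 1| ≤ 2|Y|` for `|Y| ≤ 1`. [folklore] -/
private theorem norm_exp_sub_one_le_two_mul {Y : 𝔸} (h : ‖Y‖ ≤ 1) : ‖exp Y - 1‖ ≤ 2 * ‖Y‖ := by
  have h1 := (norm_exp_sub_one_le_of_norm_le (le_refl ‖Y‖)).1
  have h2 := Real.abs_exp_sub_one_le (x := ‖Y‖) (by rwa [abs_of_nonneg (norm_nonneg _)])
  rw [abs_of_nonneg (norm_nonneg Y)] at h2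
  exact h1.trans ((le_abs_self _).trans h2)

omit [NormedAlgebra ℂ 𝔸] [CompleteSpace 𝔸] [NormOneClass 𝔸] in
/-- `‖XY − 1‖ ≤ x + y + xy` from `‖X − 1‖ ≤ x`, `‖Y − 1‖ ≤ y` (`XY − 1 = (X−1)(Y−1) + (X−1) + (Y−1)`). [folklore] -/
private theorem norm_mul_sub_one_le₃ {X Y : 𝔸} {x y : ℝ} (hX : ‖X - 1‖ ≤ x) (hY : ‖Y - 1‖ ≤ y) (hx : 0 ≤ x) :
    ‖X * Y - 1‖ ≤ x + y + x * y := by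
  have e : X * Y - 1 = (X - 1) * (Y - 1) + (X - 1) + (Y - 1) := by noncomm_ring
  rw [e]
  calc ‖(X - 1) * (Y - 1) + (X - 1) + (Y - 1)‖ ≤ ‖(X - 1) * (Y - 1)‖ + ‖X - 1‖ + ‖Y - 1‖ := norm_add₃_le
    _ ≤ x * y + x + y := by
        gcongr
        exact (norm_mul_le _ _).trans (mul_le_mul hX hY (norm_nonneg _) hx)
    _ = x + y + x * y := by ring

omit [NormedAlgebra ℂ 𝔸] [CompleteSpace 𝔸] in
/-- `‖X‖ ≤ 1 + ‖X − 1‖`. [folklore] -/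
private theorem norm_le_one_add_norm_sub_one (X : 𝔸) : ‖X‖ ≤ 1 + ‖X - 1‖ := by
  calc ‖X‖ = ‖(X - 1) + 1‖ := by rw [sub_add_cancel]
    _ ≤ ‖X - 1‖ + ‖(1 : 𝔸)‖ := norm_add_le _ _
    _ = 1 + ‖X - 1‖ := by rw [norm_one, add_comm]

/-! ## §1 The relative average (65) of a small field at a regular unit-bounded base -/

/-- `‖V̄₀(c)‖ ≤ 17∕16` for a unit-bounded base whose block loops at `c` are `α`-regular, `α ≤ 1∕64` (`V̄₀(c) = e^{X_c}·V₀(Γ_c)`, `|X_c| ≤ 2α`).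
[cite: Balaban1985Averaging, (42) p.23, (44) p.24] -/
theorem norm_val_bavg_le {L : ℕ} (hL : 1 ≤ L) {V₀ : Site d → Fin d → 𝔸ˣ} (hV₀ : ∀ x κ, V₀ x κ ∈ U1 𝔸) (q : Site d) (κ : Fin d)
    {α : ℝ} (hα1 : α ≤ 1 / 64) (hreg : ∀ r : Fin d → Fin L, ‖((Wcx L V₀ q κ (boxVec L r) : 𝔸ˣ) : 𝔸) - 1‖ ≤ α) :
    ‖((bavg L V₀ q κ : 𝔸ˣ) : 𝔸)‖ ≤ 17 / 16 := by
  have hX₀ : ‖Xavg L V₀ q κ‖ ≤ 1 / 32 := (norm_Xavg_le_of_Wcx hL _ q κ hreg (by linarith)).trans (by linarith)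
  have hE : ‖exp (Xavg L V₀ q κ) - 1‖ ≤ 1 / 16 := (norm_exp_sub_one_le_two_mul (hX₀.trans (by norm_num))).trans (by linarith)
  have h1 := norm_le_one_add_norm_sub_one (exp (Xavg L V₀ q κ))
  have h2 := (mem_U1.1 (hol_mem hV₀ q (seg κ (L : ℤ)))).1
  rw [val_bavg]
  refine (norm_mul_le _ _).trans ?_
  nlinarith [norm_nonneg (exp (Xavg L V₀ q κ)), norm_nonneg (((hol V₀ q (seg κ (L : ℤ))) : 𝔸ˣ) : 𝔸)]

/-- `‖V̄₀(c)⁻¹‖ ≤ 17∕16` likewise (`V̄₀(c)⁻¹ = V₀(Γ_c)⁻¹·e^{−X_c}`). [cite: Balaban1985Averaging, (42) p.23, (44) p.24] -/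
theorem norm_val_bavg_inv_le {L : ℕ} (hL : 1 ≤ L) {V₀ : Site d → Fin d → 𝔸ˣ} (hV₀ : ∀ x κ, V₀ x κ ∈ U1 𝔸) (q : Site d) (κ : Fin d)
    {α : ℝ} (hα1 : α ≤ 1 / 64) (hreg : ∀ r : Fin d → Fin L, ‖((Wcx L V₀ q κ (boxVec L r) : 𝔸ˣ) : 𝔸) - 1‖ ≤ α) :
    ‖(((bavg L V₀ q κ)⁻¹ : 𝔸ˣ) : 𝔸)‖ ≤ 17 / 16 := by
  have hX₀ : ‖Xavg L V₀ q κ‖ ≤ 1 / 32 := (norm_Xavg_le_of_Wcx hL _ q κ hreg (by linarith)).trans (by linarith)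
  have hE : ‖exp (-Xavg L V₀ q κ) - 1‖ ≤ 1 / 16 :=
    (norm_exp_sub_one_le_two_mul ((norm_neg _).le.trans (hX₀.trans (by norm_num)))).trans (by rw [norm_neg]; linarith)
  have h1 := norm_le_one_add_norm_sub_one (exp (-Xavg L V₀ q κ))
  have h2 := (mem_U1.1 (hol_mem hV₀ q (seg κ (L : ℤ)))).2
  have hv : (((bavg L V₀ q κ)⁻¹ : 𝔸ˣ) : 𝔸) = (((hol V₀ q (seg κ L))⁻¹ : 𝔸ˣ) : 𝔸) * exp (-Xavg L V₀ q κ) := by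
    simp only [bavg, mul_inv_rev, val_inv_expUnit, Units.val_mul, val_expUnit]
  rw [hv]
  refine (norm_mul_le _ _).trans ?_
  nlinarith [norm_nonneg (exp (-Xavg L V₀ q κ)), norm_nonneg ((((hol V₀ q (seg κ (L : ℤ))))⁻¹ : 𝔸ˣ) : 𝔸)]
set_option maxHeartbeats 400000 in
/-- **THE RELATIVE AVERAGE (65) OF A SMALL FIELD IS NEAR `1`**: for a unit-bounded base `V₀` with `α`-regular block loops at the `L`-bond
`c = (q, κ)` (`α ≤ 1∕128`) and `V₁ = e^{A}` with `sup_b|A_b| ≤ a ≤ c₃(d,L)∕48`, `‖Ṽ₁(c) − 1‖ ≤ 12416(d+1)L·a` — (92) at `k = 1`,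
`Ṽ₁(c) = w(c₋)·V̿₁(c)·R̄_{0,c}w(c₊)⁻¹`: the frames `w = e^{F}` are within `8Na` of `1` (`|F| ≤ 4Na`, `N = (2d+2)L`, from the twisted tree
holonomies within `2Na`), `V̿₁(c) = e^{Q(V₀,A,c)}` within `12288(d+1)La` (Prop. 7: `|Q| ≤ 6144(d+1)La ≤ 1`), the rotated frame within
`(17∕16)²·8Na`. [cite: Balaban1985Averaging, (65) p.29, (92) p.31, Proposition 7 p.43] -/
theorem norm_tild_expCfg_sub_one_le {L : ℕ} (hL : 1 ≤ L) {V₀ : Site d → Fin d → 𝔸ˣ} (hV₀ : ∀ x κ, V₀ x κ ∈ U1 𝔸)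
    (A : Site d → Fin d → 𝔸) {a α : ℝ} (ha : 0 ≤ a) (hA : ∀ x κ, ‖A x κ‖ ≤ a) (hac : a ≤ c3 d L / 48)
    (q : Site d) (κ : Fin d) (hα1 : α ≤ 1 / 128)
    (hreg : ∀ r : Fin d → Fin L, ‖((Wcx L V₀ q κ (boxVec L r) : 𝔸ˣ) : 𝔸) - 1‖ ≤ α) :
    ‖((tild L V₀ (expCfg A) q κ : 𝔸ˣ) : 𝔸) - 1‖ ≤ 12416 * ((d : ℝ) + 1) * L * a := by
  set N : ℝ := ((2 * (d * L) + L + L : ℕ) : ℝ) with hNdef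
  have hN : N = 2 * (((d : ℝ) + 1) * L) := by rw [hNdef]; push_cast; ring
  have hL1 : (1 : ℝ) ≤ L := by exact_mod_cast hL
  have hd0 : (0 : ℝ) ≤ d := Nat.cast_nonneg d
  have hdL : (1 : ℝ) ≤ ((d : ℝ) + 1) * L := by nlinarith
  -- the field window in the currency `t = (d+1)L·a ≤ 1∕6144`
  set t : ℝ := ((d : ℝ) + 1) * L * a with ht
  have ht0 : 0 ≤ t := by positivity
  have hc3 : c3 d L / 48 = 1 / (6144 * (((d : ℝ) + 1) * L)) := by rw [c3]; field_simp; ring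
  have ht1 : t ≤ 1 / 6144 := by
    have h := hac.trans (le_of_eq hc3)
    rw [le_div_iff₀ (by positivity)] at h
    rw [ht]; linarith
  have hac4 : a ≤ c3 d L / 4 := hac.trans (by have := c3_pos d hL; linarith)
  have hNa : N * a = 2 * t := by rw [hN, ht]; ring
  have hNa64 : N * a ≤ 1 / 64 := by rw [hNa]; linarith
  -- (i) the twisted tree holonomies and the frames
  have hτ : ∀ (w : List (Letter d)) (y : Site d), w.length ≤ 2 * (d * L) + L + L →
      ‖((tHol V₀ (expCfg A) y w : 𝔸ˣ) : 𝔸) - 1‖ ≤ 2 * (N * a) := fun w y hw =>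
    norm_tHol_expCfg_sub_one_le_of_length hV₀ A ha hA (n := 2 * (d * L) + L + L) (θ := N * a) le_rfl (by positivity) hNa64 hw y
  have htree : ∀ r : Fin d → Fin L, (treeWord (boxVec L r)).length ≤ 2 * (d * L) + L + L := fun r => by
    rw [length_treeWord]; have := l1_boxVec_le (L := L) r; omega
  have hF : ∀ y : Site d, ‖Fcov L V₀ (expCfg A) y‖ ≤ 8 * t := fun y => by
    have h := norm_Fcov_le_of_tHol hL V₀ (expCfg A) y (τ := 2 * (N * a)) (fun r => hτ _ _ (htree r)) (by linarith)
    linarith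
  have hF1 : ∀ y : Site d, ‖Fcov L V₀ (expCfg A) y‖ ≤ 1 := fun y => (hF y).trans (by linarith)
  have hw : ‖((wframe L V₀ (expCfg A) q : 𝔸ˣ) : 𝔸) - 1‖ ≤ 16 * t := by
    rw [wframe, val_expUnit]
    exact (norm_exp_sub_one_le_two_mul (hF1 q)).trans (by linarith [hF q])
  have hw' : ‖(((wframe L V₀ (expCfg A) (q + (L : ℤ) • e κ))⁻¹ : 𝔸ˣ) : 𝔸) - 1‖ ≤ 16 * t := by
    rw [wframe, val_inv_expUnit, val_expUnit]
    exact (norm_exp_sub_one_le_two_mul ((norm_neg _).le.trans (hF1 _))).trans (by rw [norm_neg]; linarith [hF (q + (L : ℤ) • e κ)])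
  -- (ii) the double-bar average `V̿₁(c) = e^{Q}`, `|Q| ≤ 6144(d+1)La ≤ 1`
  have hU0 : ∀ (x : Site d) (κ' : Fin d), ‖(((1 : Site d → Fin d → 𝔸ˣ) x κ' : 𝔸ˣ) : 𝔸) - 1‖ ≤ 0 ∧
      ‖((((1 : Site d → Fin d → 𝔸ˣ) x κ')⁻¹ : 𝔸ˣ) : 𝔸) - 1‖ ≤ 0 := fun x κ' => by simp
  have hQ : ‖Qcov L V₀ A q κ‖ ≤ 6144 * t := by
    have h := (norm_Qcov_cplx_le_crude_explicit hL hV₀ le_rfl hU0 (by rw [mul_zero]; norm_num) A ha hA hac4 q κ hα1 hreg).2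
    rw [one_mul] at h
    rw [ht]; linarith
  have hQ1 : ‖Qcov L V₀ A q κ‖ ≤ 1 := hQ.trans (by linarith)
  have hDdom : ‖((dbavgCov L V₀ (expCfg A) q κ : 𝔸ˣ) : 𝔸) - 1‖ < 1 :=
    (logDomainCov hL hV₀ A ha hA (θ := N * a) le_rfl (by positivity) hNa64 q κ (hα1.trans (by norm_num)) hreg).2.2.2.trans_lt
      (by norm_num)
  have hD : ‖((dbavgCov L V₀ (expCfg A) q κ : 𝔸ˣ) : 𝔸) - 1‖ ≤ 12288 * t := by
    have e1 : ((dbavgCov L V₀ (expCfg A) q κ : 𝔸ˣ) : 𝔸) = exp (Qcov L V₀ A q κ) := by rw [Qcov, exp_mlog hDdom]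
    rw [e1]
    exact (norm_exp_sub_one_le_two_mul hQ1).trans (by linarith)
  -- (iii) the rotated frame `V̄₀(c)·w(c₊)⁻¹·V̄₀(c)⁻¹`
  have hb := norm_val_bavg_le hL hV₀ q κ (hα1.trans (by norm_num)) hreg
  have hb' := norm_val_bavg_inv_le hL hV₀ q κ (hα1.trans (by norm_num)) hreg
  have hZ : ‖((bavg L V₀ q κ : 𝔸ˣ) : 𝔸) * (((wframe L V₀ (expCfg A) (q + (L : ℤ) • e κ))⁻¹ : 𝔸ˣ) : 𝔸) *
      (((bavg L V₀ q κ)⁻¹ : 𝔸ˣ) : 𝔸) - 1‖ ≤ 20 * t := by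
    have he : ((bavg L V₀ q κ : 𝔸ˣ) : 𝔸) * (((wframe L V₀ (expCfg A) (q + (L : ℤ) • e κ))⁻¹ : 𝔸ˣ) : 𝔸) *
        (((bavg L V₀ q κ)⁻¹ : 𝔸ˣ) : 𝔸) - 1 =
        ((bavg L V₀ q κ : 𝔸ˣ) : 𝔸) * ((((wframe L V₀ (expCfg A) (q + (L : ℤ) • e κ))⁻¹ : 𝔸ˣ) : 𝔸) - 1) *
          (((bavg L V₀ q κ)⁻¹ : 𝔸ˣ) : 𝔸) := by
      rw [mul_sub, sub_mul, mul_one, Units.mul_inv]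
    rw [he]
    calc _ ≤ ‖((bavg L V₀ q κ : 𝔸ˣ) : 𝔸)‖ * ‖(((wframe L V₀ (expCfg A) (q + (L : ℤ) • e κ))⁻¹ : 𝔸ˣ) : 𝔸) - 1‖ *
          ‖(((bavg L V₀ q κ)⁻¹ : 𝔸ˣ) : 𝔸)‖ := (norm_mul_le _ _).trans (mul_le_mul_of_nonneg_right (norm_mul_le _ _) (norm_nonneg _))
      _ ≤ 17 / 16 * (16 * t) * (17 / 16) :=
          mul_le_mul (mul_le_mul hb hw' (norm_nonneg _) (by norm_num)) hb' (norm_nonneg _) (by positivity)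
      _ ≤ 20 * t := by linarith
  -- assemble (92) at `k = 1`
  have htild : ((tild L V₀ (expCfg A) q κ : 𝔸ˣ) : 𝔸) =
      ((wframe L V₀ (expCfg A) q : 𝔸ˣ) : 𝔸) * ((dbavgCov L V₀ (expCfg A) q κ : 𝔸ˣ) : 𝔸) *
        (((bavg L V₀ q κ : 𝔸ˣ) : 𝔸) * (((wframe L V₀ (expCfg A) (q + (L : ℤ) • e κ))⁻¹ : 𝔸ˣ) : 𝔸) *
          (((bavg L V₀ q κ)⁻¹ : 𝔸ˣ) : 𝔸)) := by
    rw [tild_eq_frame_dbavgCov, ← map_inv, Rc_apply, Units.val_mul, Units.val_mul, Units.val_mul, Units.val_mul]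
  have h1 := norm_mul_sub_one_le₃ hw hD (by positivity)
  have h2 := norm_mul_sub_one_le₃ h1 hZ (by positivity)
  rw [htild]
  refine h2.trans ?_
  have ht2 : t * t ≤ t / 6144 := by nlinarith
  have ht3 : t * t * t ≤ t / 6144 / 6144 := by nlinarith
  have hgoal : 12416 * ((d : ℝ) + 1) * L * a = 12416 * t := by rw [ht]; ring
  rw [hgoal]
  nlinarith [ht2, ht3, ht0]

/-- **`‖\overline{e^{A}V₀}(c) − V̄₀(c)‖ ≤ 13192(d+1)L·a`** in the regime of `norm_tild_expCfg_sub_one_le`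
(`\overline{V₁V₀}(c) − V̄₀(c) = (Ṽ₁(c) − 1)·V̄₀(c)`, `‖V̄₀(c)‖ ≤ 17∕16`). [cite: Balaban1985Averaging, (42) p.23, (65) p.29, Proposition 7 p.43] -/
theorem norm_bavg_expCfg_mul_sub_bavg_le {L : ℕ} (hL : 1 ≤ L) {V₀ : Site d → Fin d → 𝔸ˣ} (hV₀ : ∀ x κ, V₀ x κ ∈ U1 𝔸)
    (A : Site d → Fin d → 𝔸) {a α : ℝ} (ha : 0 ≤ a) (hA : ∀ x κ, ‖A x κ‖ ≤ a) (hac : a ≤ c3 d L / 48)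
    (q : Site d) (κ : Fin d) (hα1 : α ≤ 1 / 128)
    (hreg : ∀ r : Fin d → Fin L, ‖((Wcx L V₀ q κ (boxVec L r) : 𝔸ˣ) : 𝔸) - 1‖ ≤ α) :
    ‖((bavg L (expCfg A * V₀) q κ : 𝔸ˣ) : 𝔸) - ((bavg L V₀ q κ : 𝔸ˣ) : 𝔸)‖ ≤ 13192 * ((d : ℝ) + 1) * L * a := by
  have e1 : ((bavg L (expCfg A * V₀) q κ : 𝔸ˣ) : 𝔸) - ((bavg L V₀ q κ : 𝔸ˣ) : 𝔸) =
      (((tild L V₀ (expCfg A) q κ : 𝔸ˣ) : 𝔸) - 1) * ((bavg L V₀ q κ : 𝔸ˣ) : 𝔸) := by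
    rw [tild_apply, Units.val_mul, sub_mul, one_mul, Units.inv_mul_cancel_right]
  rw [e1]
  have h1 := norm_tild_expCfg_sub_one_le hL hV₀ A ha hA hac q κ hα1 hreg
  have h2 := norm_val_bavg_le hL hV₀ q κ (hα1.trans (by norm_num)) hreg
  have h0 : 0 ≤ 12416 * ((d : ℝ) + 1) * L * a := by positivity
  calc _ ≤ ‖((tild L V₀ (expCfg A) q κ : 𝔸ˣ) : 𝔸) - 1‖ * ‖((bavg L V₀ q κ : 𝔸ˣ) : 𝔸)‖ := norm_mul_le _ _
    _ ≤ 12416 * ((d : ℝ) + 1) * L * a * (17 / 16) := mul_le_mul h1 h2 (norm_nonneg _) h0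
    _ = 13192 * ((d : ℝ) + 1) * L * a := by ring

/-! ## §2 Two backgrounds: the one-step average is Lipschitz in the configuration -/

/-- **THE ONE-STEP AVERAGE (42) IS LIPSCHITZ IN THE CONFIGURATION**: for a unit-bounded base `V′` with `α′`-regular block loops at the `L`-bond
`c` (`α′ ≤ 1∕128`) and a configuration `V` with `‖V(b)V′(b)⁻¹ − 1‖ ≤ δ ≤ 1∕(12288(d+1)L)` (print's `exp(iB)V′` with `sup|B| = O(δ)`),
`‖V̄(c) − V̄′(c)‖ ≤ 26384(d+1)L·δ` — §1 at the field `A = log(VV′⁻¹)` (`|A_b| ≤ 2δ`, `e^{A}V′ = V`).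
[cite: Balaban1985Averaging, (42) p.23, (65) p.29, Proposition 7 p.43] -/
theorem norm_bavg_sub_bavg_le {L : ℕ} (hL : 1 ≤ L) {V V' : Site d → Fin d → 𝔸ˣ} (hV' : ∀ x κ, V' x κ ∈ U1 𝔸)
    (q : Site d) (κ : Fin d) {α' : ℝ} (hα1' : α' ≤ 1 / 128)
    (hreg' : ∀ r : Fin d → Fin L, ‖((Wcx L V' q κ (boxVec L r) : 𝔸ˣ) : 𝔸) - 1‖ ≤ α')
    {δ : ℝ} (hδ : 0 ≤ δ) (hδmax : δ ≤ 1 / (12288 * ((d : ℝ) + 1) * L))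
    (hVδ : ∀ x κ, ‖((V x κ : 𝔸ˣ) : 𝔸) * (((V' x κ)⁻¹ : 𝔸ˣ) : 𝔸) - 1‖ ≤ δ) :
    ‖((bavg L V q κ : 𝔸ˣ) : 𝔸) - ((bavg L V' q κ : 𝔸ˣ) : 𝔸)‖ ≤ 26384 * ((d : ℝ) + 1) * L * δ := by
  have hL1 : (1 : ℝ) ≤ L := by exact_mod_cast hL
  have hd0 : (0 : ℝ) ≤ d := Nat.cast_nonneg d
  have hdL : (1 : ℝ) ≤ ((d : ℝ) + 1) * L := by nlinarith
  have hδ2 : δ ≤ 1 / 2 := hδmax.trans (by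
    rw [div_le_div_iff₀ (by positivity) (by norm_num)]; nlinarith)
  set X : Site d → Fin d → 𝔸 := fun x κ => mlog (((V x κ : 𝔸ˣ) : 𝔸) * (((V' x κ)⁻¹ : 𝔸ˣ) : 𝔸)) with hXdef
  have hX : ∀ x κ', ‖X x κ'‖ ≤ 2 * δ := fun x κ' =>
    (norm_mlog_le_two_mul ((hVδ x κ').trans hδ2)).trans (by linarith [hVδ x κ'])
  have hVexp : expCfg X * V' = V := expCfg_mlog_mul V V' fun x κ' => (hVδ x κ').trans_lt (by linarith)
  have hac : 2 * δ ≤ c3 d L / 48 := by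
    have e1 : c3 d L / 48 = 2 * (1 / (12288 * ((d : ℝ) + 1) * L)) := by rw [c3]; field_simp; ring
    rw [e1]; linarith
  have h := norm_bavg_expCfg_mul_sub_bavg_le hL hV' X (by positivity) hX hac q κ hα1' hreg'
  rw [hVexp] at h
  exact h.trans (le_of_eq (by ring))

/-- **… IN THE SMALL-BOND CURRENCY OF THE NE9 CHAIN**: for `V′(b) ∈ U1` with `‖V′(b) − 1‖ ≤ ε′`, `2(d+1)L·ε′ ≤ 1∕128` (so that every block loop
of `V′` is `2(d+1)Lε′`-regular, `B9Eq315QLipschitz.norm_Wcx_sub_one_le`) and `‖V(b) − V′(b)‖ ≤ δ ≤ 1∕(12288(d+1)L)` (hence `‖V(b)V′(b)⁻¹ − 1‖ ≤ δ`),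
`‖V̄(c) − V̄′(c)‖ ≤ 26384(d+1)L·δ` at EVERY `L`-bond `c`. [cite: Balaban1985Averaging, (42) p.23, (44) p.24, Proposition 7 p.43] -/
theorem norm_bavg_sub_bavg_le_of_bonds {L : ℕ} (hL : 1 ≤ L) {V V' : Site d → Fin d → 𝔸ˣ} (hV' : ∀ x κ, V' x κ ∈ U1 𝔸)
    {ε' : ℝ} (hε' : 0 ≤ ε') (hV'ε : ∀ x κ, ‖((V' x κ : 𝔸ˣ) : 𝔸) - 1‖ ≤ ε') (hε'reg : 2 * ((d : ℝ) + 1) * L * ε' ≤ 1 / 128)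
    {δ : ℝ} (hδ : 0 ≤ δ) (hδmax : δ ≤ 1 / (12288 * ((d : ℝ) + 1) * L))
    (hVV' : ∀ x κ, ‖((V x κ : 𝔸ˣ) : 𝔸) - ((V' x κ : 𝔸ˣ) : 𝔸)‖ ≤ δ) (q : Site d) (κ : Fin d) :
    ‖((bavg L V q κ : 𝔸ˣ) : 𝔸) - ((bavg L V' q κ : 𝔸ˣ) : 𝔸)‖ ≤ 26384 * ((d : ℝ) + 1) * L * δ := by
  have hreg : ∀ r : Fin d → Fin L, ‖((Wcx L V' q κ (boxVec L r) : 𝔸ˣ) : 𝔸) - 1‖ ≤ 2 * ((d : ℝ) + 1) * L * ε' :=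
    fun r => norm_Wcx_sub_one_le hV' hV'ε L q κ r hε'
  -- the multiplicative closeness letter from the additive one (`uu′⁻¹ − 1 = (u − u′)u′⁻¹`, `‖u′⁻¹‖ ≤ 1`)
  have hVδ : ∀ x κ', ‖((V x κ' : 𝔸ˣ) : 𝔸) * (((V' x κ')⁻¹ : 𝔸ˣ) : 𝔸) - 1‖ ≤ δ := fun x κ' => by
    have e1 : ((V x κ' : 𝔸ˣ) : 𝔸) * (((V' x κ')⁻¹ : 𝔸ˣ) : 𝔸) - 1 = (((V x κ' : 𝔸ˣ) : 𝔸) - ((V' x κ' : 𝔸ˣ) : 𝔸)) * (((V' x κ')⁻¹ : 𝔸ˣ) : 𝔸) := by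
      rw [sub_mul, Units.mul_inv]
    rw [e1]
    exact (norm_mul_le _ _).trans ((mul_le_of_le_one_right (norm_nonneg _) (mem_U1.1 (hV' x κ')).2).trans (hVV' x κ'))
  exact norm_bavg_sub_bavg_le hL hV' q κ hε'reg hreg hδ hδmax hVδ

/-! ## §3 Along the tower (43): the `J`-fold averages of two configurations -/

/-- **THE `J`-FOLD AVERAGES (43) OF TWO CONFIGURATIONS STAY CLOSE**: if the base's level averages `V̄′^j`, `j < J`, are `U1`-valued with
`ε′`-small bonds (`2(d+1)Lε′ ≤ 1∕128`; DISPLAYED — [Balaban1985Averaging] Prop. 2 and an averaging-closed subgroup), `‖V(b) − V′(b)‖ ≤ δ` and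
`(26384(d+1)L)^J·δ ≤ 1∕(12288(d+1)L)` (every intermediate closeness stays in §2's window), then `‖V̄^J(b) − V̄′^J(b)‖ ≤ (26384(d+1)L)^J·δ` —
induction on (43); the rescaling `B7Prop2Explicit.rescale` only relabels bonds. [cite: Balaban1985Averaging, (42)–(43) pp.23–24, Proposition 7 p.43] -/
theorem norm_avgIter_sub_avgIter_le {L : ℕ} (hL : 1 ≤ L) {V V' : Site d → Fin d → 𝔸ˣ} {ε' : ℝ} (hε' : 0 ≤ ε')
    (hε'reg : 2 * ((d : ℝ) + 1) * L * ε' ≤ 1 / 128) {δ : ℝ} (hδ : 0 ≤ δ)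
    (hVV' : ∀ x κ, ‖((V x κ : 𝔸ˣ) : 𝔸) - ((V' x κ : 𝔸ˣ) : 𝔸)‖ ≤ δ) :
    ∀ J : ℕ, (∀ j, j < J → ∀ (x : Site d) (κ : Fin d), avgIter L V' j x κ ∈ U1 𝔸) →
      (∀ j, j < J → ∀ (x : Site d) (κ : Fin d), ‖((avgIter L V' j x κ : 𝔸ˣ) : 𝔸) - 1‖ ≤ ε') →
      (26384 * ((d : ℝ) + 1) * L) ^ J * δ ≤ 1 / (12288 * ((d : ℝ) + 1) * L) →
      ∀ (x : Site d) (κ : Fin d),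
        ‖((avgIter L V J x κ : 𝔸ˣ) : 𝔸) - ((avgIter L V' J x κ : 𝔸ˣ) : 𝔸)‖ ≤ (26384 * ((d : ℝ) + 1) * L) ^ J * δ
  | 0, _, _, _, x, κ => by simpa using hVV' x κ
  | J + 1, hU1, hUε, hs, x, κ => by
    have hL1 : (1 : ℝ) ≤ L := by exact_mod_cast hL
    have hd0 : (0 : ℝ) ≤ d := Nat.cast_nonneg d
    have hC1 : (1 : ℝ) ≤ 26384 * ((d : ℝ) + 1) * L := by nlinarith
    have hCJ : 0 ≤ (26384 * ((d : ℝ) + 1) * L) ^ J * δ := by positivity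
    -- the window at `J` follows from the one at `J+1`
    have hs' : (26384 * ((d : ℝ) + 1) * L) ^ J * δ ≤ 1 / (12288 * ((d : ℝ) + 1) * L) := by
      have hmono : (26384 * ((d : ℝ) + 1) * L) ^ J * δ ≤ (26384 * ((d : ℝ) + 1) * L) ^ (J + 1) * δ := by
        rw [pow_succ]
        exact mul_le_mul_of_nonneg_right (le_mul_of_one_le_right (by positivity) hC1) hδ
      exact hmono.trans hs
    have ih := norm_avgIter_sub_avgIter_le hL hε' hε'reg hδ hVV' J (fun j hj => hU1 j (Nat.lt_succ_of_lt hj))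
      (fun j hj => hUε j (Nat.lt_succ_of_lt hj)) hs'
    rw [avgIter_succ, rescale_apply, avgIter_succ, rescale_apply]
    calc ‖((bavg L (avgIter L V J) ((L : ℤ) • x) κ : 𝔸ˣ) : 𝔸) - ((bavg L (avgIter L V' J) ((L : ℤ) • x) κ : 𝔸ˣ) : 𝔸)‖
        ≤ 26384 * ((d : ℝ) + 1) * L * ((26384 * ((d : ℝ) + 1) * L) ^ J * δ) :=
          norm_bavg_sub_bavg_le_of_bonds hL (hU1 J (Nat.lt_succ_self J)) hε' (hUε J (Nat.lt_succ_self J)) hε'reg hCJ hs' ih _ κ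
      _ = (26384 * ((d : ℝ) + 1) * L) ^ (J + 1) * δ := by rw [pow_succ]; ring

/-! ## §4 The tower reading: the level backgrounds `UlevOf` of two backgrounds of the finest torus -/

/-- **THE LEVEL BACKGROUNDS OF TWO CLOSE BACKGROUNDS OF THE FINEST TORUS ARE CLOSE** — the `hUU'` display of
`B9Eq315QTowerLipschitzTwoBackgrounds.norm_QprimeTowerW_sub_QprimeTowerW_le` ∕ `norm_QkW_sub_QkW_le` PRODUCED: for `U`, `U′` on `T_{L^k m}`
with `‖U(b) − U′(b)‖ ≤ δ`, `(26384(d+1)L)^k·δ ≤ 1∕(12288(d+1)L)`, and the base's level averages `U1`-valued with `ε̄′`-small bonds,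
`2(d+1)Lε̄′ ≤ 1∕128` (the SAME displayed letters `hUb'`, `hUε'` of that file), every level background satisfies
`‖UlevOf L m k U j b − UlevOf L m k U′ j b‖ ≤ (26384(d+1)L)^k·δ` (`UlevOf … j = Ū^{k−1−j}` read at representatives, `B9Eq315QTower.perCfg_UlevOf`;
§3 at `J = k−1−j ≤ k`). [cite: Balaban1985Averaging, (42)–(43) pp.23–24; Balaban1985BackgroundPropagators, (3.15) p.393] -/
theorem norm_UlevOf_sub_UlevOf_le (L : ℕ) [NeZero L] (hL : 1 ≤ L) (m : Fin d → ℕ) [∀ i, NeZero (m i)] (k : ℕ)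
    (U U' : Bond d (towerP L m k) → 𝔸ˣ)
    (hUb' : ∀ (n : ℕ) (b : Bond d (towerP L m (n + 1))), UlevOf L m k U' n b ∈ U1 𝔸)
    {ε' : ℝ} (hε' : 0 ≤ ε') (hUε' : ∀ (n : ℕ) (b : Bond d (towerP L m (n + 1))), ‖((UlevOf L m k U' n b : 𝔸ˣ) : 𝔸) - 1‖ ≤ ε')
    (hε'reg : 2 * ((d : ℝ) + 1) * L * ε' ≤ 1 / 128) {δ : ℝ} (hδ : 0 ≤ δ)
    (hUU' : ∀ b : Bond d (towerP L m k), ‖((U b : 𝔸ˣ) : 𝔸) - ((U' b : 𝔸ˣ) : 𝔸)‖ ≤ δ)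
    (hs : (26384 * ((d : ℝ) + 1) * L) ^ k * δ ≤ 1 / (12288 * ((d : ℝ) + 1) * L))
    (n : ℕ) (b : Bond d (towerP L m (n + 1))) :
    ‖((UlevOf L m k U n b : 𝔸ˣ) : 𝔸) - ((UlevOf L m k U' n b : 𝔸ˣ) : 𝔸)‖ ≤ (26384 * ((d : ℝ) + 1) * L) ^ k * δ := by
  have hL1 : (1 : ℝ) ≤ L := by exact_mod_cast hL
  have hd0 : (0 : ℝ) ≤ d := Nat.cast_nonneg d
  have hC1 : (1 : ℝ) ≤ 26384 * ((d : ℝ) + 1) * L := by nlinarith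
  have hVV' : ∀ (x : Site d) (κ : Fin d),
      ‖((perCfg (towerP L m k) U x κ : 𝔸ˣ) : 𝔸) - ((perCfg (towerP L m k) U' x κ : 𝔸ˣ) : 𝔸)‖ ≤ δ := fun x κ => by
    rw [perCfg_apply, perCfg_apply]; exact hUU' _
  -- the level averages of the base on `ℤ^d` ARE the displayed `UlevOf` letters (`perCfg_UlevOf`)
  have hlev : ∀ j, j < k - 1 - n → ∀ (x : Site d) (κ : Fin d),
      avgIter L (perCfg (towerP L m k) U') j x κ = UlevOf L m k U' (k - 1 - j) (perSite (towerP L m (k - 1 - j + 1)) x, κ) := by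
    intro j hj x κ
    have hjk : k - 1 - j + 1 ≤ k := by omega
    have e1 := perCfg_UlevOf L m hjk U'
    rw [show k - 1 - (k - 1 - j) = j by omega] at e1
    rw [← e1, perCfg_apply]
  have hU1 : ∀ j, j < k - 1 - n → ∀ (x : Site d) (κ : Fin d), avgIter L (perCfg (towerP L m k) U') j x κ ∈ U1 𝔸 :=
    fun j hj x κ => by rw [hlev j hj x κ]; exact hUb' _ _
  have hUε : ∀ j, j < k - 1 - n → ∀ (x : Site d) (κ : Fin d), ‖((avgIter L (perCfg (towerP L m k) U') j x κ : 𝔸ˣ) : 𝔸) - 1‖ ≤ ε' :=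
    fun j hj x κ => by rw [hlev j hj x κ]; exact hUε' _ _
  have hmono : (26384 * ((d : ℝ) + 1) * L) ^ (k - 1 - n) * δ ≤ (26384 * ((d : ℝ) + 1) * L) ^ k * δ :=
    mul_le_mul_of_nonneg_right (pow_le_pow_right₀ hC1 (by omega)) hδ
  exact (norm_avgIter_sub_avgIter_le hL hε' hε'reg hδ hVV' (k - 1 - n) hU1 hUε (hmono.trans hs) _ _).trans hmono

end Literature.MathematicalPhysics.QuantumFieldTheory.Balaban1983to89.B7Eq65AverageLipschitz

end
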